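import Summits.HubbardSuperconductivity.HubbardSuperconductivity.Theorems.LevyLogBootstrapDressHalfFilledDictionaryOfData
import HarnessLib

/-!
# Route `LevyLogBootstrap` / `AnisotropyChord`, crux `DressHalfFilled` (stmt-HubbardSuperconductivity-8148): the registered
# stub `stub_plaquetteDictionary` of the skeleton `Cruxes/DressHalfFilled/Lines/birth.lean` (sha `a478c14270dc…`), BY NAME

The skeleton's two statement abbreviations `PlaquetteData U` (certified one/two-plaquette data (W1)–(W5)) and
`PlaquetteDictionary U` (the plaquette-boson dictionary to second order: isometry `Φ`, sectors and `E₀`-eigenspace,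
exhaustion, Kato's kernel `T S(E₀) T` pulls back to `-(2J·XXZ(Δ_eff) + k(N_b))`, `Φᴴ Δ_d Φ = c Σ S⁺`) are landed here
VERBATIM (the skeleton is not importable from `Theorems/`; same text, same meaning — cf. `…AnisotropyChordThermalCondensateDefs`
for the sister crux `ChordXY`), so that the registered stub

  `stub_plaquetteDictionary : ∀ U : ℝ, 0 < U → PlaquetteData U → PlaquetteDictionary U`

is stated and PROVED by name: it is `…DictionaryOfData.plaquetteDictionary_of_plaquetteData` (the dictionary
`Φ = TorusPlaquette.dictionaryMap M U` of `Literature/…/TorusPlaquetteDictionaryMap`, clauses (a)(b) there, (c)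
`…DictionaryExhaustion`, (d) `…InterLocality` + `…KernelTableOfUnique` + `…KernelXXZOfUnique` + `…DictionaryLocality`,
(e) `…DictionaryPairField`, assembled by `…DictionaryAssembly`). No `U`-window: the two-plaquette kernel table is derived
from the (W4) clauses of the data, so the stub closes exactly as registered (the hypothesis `0 < U` is not even used).

HONEST LABEL: this closes ONE registered stub (stub 2 of 3) of one line of the crux `DressHalfFilled`; stub 1 (certified
plaquette data at some `U`) and stub 3 (the dressing — the open, load-bearing statement) remain; no crux and no summit
statement is proved here.

References: W.-F. Tsai, S. A. Kivelson, PRB 73 (2006) 214510, Table I, App. A (A1) [TsaiKivelson2006]; H. Yao, W.-F. Tsai,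
S. A. Kivelson, PRB 76 (2007) 161104(R), eq. (2), p. 4 [YaoTsaiKivelson2007]; T. Kato (1966) II-§2.2 (2.20); E. H. Lieb,
PRL 62 (1989) 1201. The two `def`s are statement abbreviations copied from the registered skeleton (no new mathematical
content, no named fact).
-/

set_option linter.dupNamespace false

noncomputable section

namespace Summit.HubbardSuperconductivity.HubbardSuperconductivity.Theorems.LevyLogBootstrap

open scoped BigOperators Matrix ComplexOrder
open Matrix Finset
open Literature.Probability.LatticeModels Literature.MathematicalPhysics.QuantumLattice

/-- **PLAQUETTE DATA at the coupling `U`** — verbatim the skeleton's `PlaquetteData` (`Cruxes/DressHalfFilled/Lines/birth.lean`,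
shared with `Cruxes/DressAnyFilling/Lines/birth.lean`): (W1) `0 < J(U)`, `0 ≤ V(U) < 2J(U)` (so `Δ_eff ∈ (-1,0]`);
(W2) `0 < c(U)`; (W3) pair binding, pair exclusion and the strict chord condition on the plaquette charge; (W4) the `(4,0)`
and `(2,0)` plaquette ground states are unique up to phase; (W5) they lie strictly below the `S^z ≠ 0` sectors of the same
charge. Tsai–Kivelson 2006, Table I, App. A; Yao–Tsai–Kivelson 2007, eq. (2), p. 4; Lieb 1989. [folklore] -/
def PlaquetteData (U : ℝ) : Prop :=
  (0 < (plaquettePairCouplings U).J ∧ 0 ≤ (plaquettePairCouplings U).V ∧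
      (plaquettePairCouplings U).V < 2 * (plaquettePairCouplings U).J) ∧
  0 < (plaquettePairCouplings U).c ∧
  (0 < (plaquettePairCouplings U).pairBinding ∧ 0 < (plaquettePairCouplings U).pairExclusion ∧
    ∀ n : ℕ, n ≤ 8 → n ≠ 2 → n ≠ 4 →
      (4 - (n : ℝ)) * groundEnergyAt plaquetteGraph 1 U 2 + ((n : ℝ) - 2) * groundEnergyAt plaquetteGraph 1 U 4 <
        2 * groundEnergyAt plaquetteGraph 1 U n) ∧
  (∀ φ₁ φ₂ : Fock (Orb PlaquetteSite), IsGroundStateInSector (plaquetteHamiltonian U) 4 0 φ₁ →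
    IsGroundStateInSector (plaquetteHamiltonian U) 4 0 φ₂ → ∃ a : ℂ, φ₂ = a • φ₁) ∧
  (∀ φ₁ φ₂ : Fock (Orb PlaquetteSite), IsGroundStateInSector (plaquetteHamiltonian U) 2 0 φ₁ →
    IsGroundStateInSector (plaquetteHamiltonian U) 2 0 φ₂ → ∃ a : ℂ, φ₂ = a • φ₁) ∧
  (∀ m : ℝ, m = 1 ∨ m = -1 ∨ m = 2 ∨ m = -2 →
    (plaquetteHamiltonian U).minEnergyOn (szSector 4 0) < (plaquetteHamiltonian U).minEnergyOn (szSector 4 m)) ∧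
  (∀ m : ℝ, m = 1 ∨ m = -1 →
    (plaquetteHamiltonian U).minEnergyOn (szSector 2 0) < (plaquetteHamiltonian U).minEnergyOn (szSector 2 m))

/-- **THE PLAQUETTE-BOSON DICTIONARY at `U` to second order** — verbatim the skeleton's `PlaquetteDictionary`: for every
side `L = 2M ≥ 8` with `4 ∣ L` an isometry `Φ` from the `S = ½` space of the `M × M` plaquette torus into the electron Fock
space of the `L × L` torus with (a) `Φᴴ Φ = 1`, (b) boson sector `N_b` ↦ electron sector `(L² − 2N_b, S^z = 0)` inside the
`E₀(N_b)`-eigenspace of `H_in`, (c) exhaustion of that sector ground space, (d) `⟨Φφ', T S(E₀) T Φφ⟩ =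
-⟨φ', (2J·xxzHamiltonian 1 (torusGraph 2 M) (-1) Δ_eff + k(N_b)) φ⟩`, (e) `Φᴴ Δ_d Φ = c Σ_R S⁺_R`.
Tsai–Kivelson 2006, App. A (A1); Yao–Tsai–Kivelson 2007, eq. (2); Kato 1966, II-§2.2 (2.20). [folklore] -/
def PlaquetteDictionary (U : ℝ) : Prop :=
  ∀ (L M : ℕ) [NeZero L] [NeZero M], L = 2 * M → 8 ≤ L → 4 ∣ L →
    let C := plaquettePairCouplings U;
    let Hin := hamiltonian ((fermionTorusGraph 2 L) \ SimpleGraph.comap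
      (fun x : FermionTorus 2 L => fun i : Fin 2 => ((ofLex x) i : ℕ) / 2) ⊤) 1 U;
    let T := hamiltonian ((fermionTorusGraph 2 L) ⊓ SimpleGraph.comap
      (fun x : FermionTorus 2 L => fun i : Fin 2 => ((ofLex x) i : ℕ) / 2) ⊤) 1 0;
    let E₀ : ℕ → ℝ := fun Nb => ((M : ℝ) ^ 2 - (Nb : ℝ)) * C.E 0 + (Nb : ℝ) * C.E 2;
    ∃ Φ : Matrix (Finset (Orb (FermionTorus 2 L))) (TensorIndex (TorusSite 2 M) 2) ℂ,
      Φᴴ * Φ = 1 ∧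
      (∀ Nb : ℕ, Nb ≤ M ^ 2 → ∀ φ : TensorIndex (TorusSite 2 M) 2 → ℂ,
        φ ∈ spinZSector (Λ := TorusSite 2 M) 1 ((Nb : ℝ) - (M : ℝ) ^ 2 / 2) →
        Φ *ᵥ φ ∈ szSector (Λ := FermionTorus 2 L) (L ^ 2 - 2 * Nb) 0 ∧
        Hin *ᵥ (Φ *ᵥ φ) = ((E₀ Nb : ℝ) : ℂ) • (Φ *ᵥ φ)) ∧
      (∀ Nb : ℕ, Nb ≤ M ^ 2 →
        Hin.minEnergyOn (szSector (Λ := FermionTorus 2 L) (L ^ 2 - 2 * Nb) 0) = E₀ Nb ∧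
        ∀ ψ : Fock (Orb (FermionTorus 2 L)), ψ ∈ szSector (Λ := FermionTorus 2 L) (L ^ 2 - 2 * Nb) 0 →
          Hin *ᵥ ψ = ((E₀ Nb : ℝ) : ℂ) • ψ →
          ∃ φ : TensorIndex (TorusSite 2 M) 2 → ℂ,
            φ ∈ spinZSector (Λ := TorusSite 2 M) 1 ((Nb : ℝ) - (M : ℝ) ^ 2 / 2) ∧ ψ = Φ *ᵥ φ) ∧
      (∃ k : ℕ → ℝ, ∀ Nb : ℕ, Nb ≤ M ^ 2 → ∀ φ φ' : TensorIndex (TorusSite 2 M) 2 → ℂ,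
        φ ∈ spinZSector (Λ := TorusSite 2 M) 1 ((Nb : ℝ) - (M : ℝ) ^ 2 / 2) →
        φ' ∈ spinZSector (Λ := TorusSite 2 M) 1 ((Nb : ℝ) - (M : ℝ) ^ 2 / 2) →
        star (Φ *ᵥ φ') ⬝ᵥ ((T * reducedResolvent Hin (E₀ Nb) * T) *ᵥ (Φ *ᵥ φ)) =
          -(star φ' ⬝ᵥ ((((2 * C.J : ℝ) : ℂ) • xxzHamiltonian 1 (torusGraph 2 M) (-1) C.ΔEff +
            ((k Nb : ℝ) : ℂ) • 1) *ᵥ φ))) ∧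
      Φᴴ * pairField dWaveFormFactor L * Φ = ((C.c : ℝ) : ℂ) • ∑ R : TorusSite 2 M, onSite R (spinRaise 1)

/-- `PlaquetteData U` is its body (for rewriting). [bookkeeping] -/
theorem plaquetteData_iff (U : ℝ) : PlaquetteData U ↔
  ((0 < (plaquettePairCouplings U).J ∧ 0 ≤ (plaquettePairCouplings U).V ∧
      (plaquettePairCouplings U).V < 2 * (plaquettePairCouplings U).J) ∧
  0 < (plaquettePairCouplings U).c ∧
  (0 < (plaquettePairCouplings U).pairBinding ∧ 0 < (plaquettePairCouplings U).pairExclusion ∧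
    ∀ n : ℕ, n ≤ 8 → n ≠ 2 → n ≠ 4 →
      (4 - (n : ℝ)) * groundEnergyAt plaquetteGraph 1 U 2 + ((n : ℝ) - 2) * groundEnergyAt plaquetteGraph 1 U 4 <
        2 * groundEnergyAt plaquetteGraph 1 U n) ∧
  (∀ φ₁ φ₂ : Fock (Orb PlaquetteSite), IsGroundStateInSector (plaquetteHamiltonian U) 4 0 φ₁ →
    IsGroundStateInSector (plaquetteHamiltonian U) 4 0 φ₂ → ∃ a : ℂ, φ₂ = a • φ₁) ∧
  (∀ φ₁ φ₂ : Fock (Orb PlaquetteSite), IsGroundStateInSector (plaquetteHamiltonian U) 2 0 φ₁ →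
    IsGroundStateInSector (plaquetteHamiltonian U) 2 0 φ₂ → ∃ a : ℂ, φ₂ = a • φ₁) ∧
  (∀ m : ℝ, m = 1 ∨ m = -1 ∨ m = 2 ∨ m = -2 →
    (plaquetteHamiltonian U).minEnergyOn (szSector 4 0) < (plaquetteHamiltonian U).minEnergyOn (szSector 4 m)) ∧
  (∀ m : ℝ, m = 1 ∨ m = -1 →
    (plaquetteHamiltonian U).minEnergyOn (szSector 2 0) < (plaquetteHamiltonian U).minEnergyOn (szSector 2 m))) :=
  Iff.rfl

/-- **Registered stub `stub_plaquetteDictionary` (skeleton `Lines/birth.lean`, sha `a478c14270dc…`), BY NAME, signature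
verbatim**: at every coupling carrying the plaquette data, the plaquette-boson dictionary to second order holds —
`…DictionaryOfData.plaquetteDictionary_of_plaquetteData` read through the two abbreviations (the hypothesis `0 < U` is
unused). [cite: TsaiKivelson2006, App. A (A1)] -/
theorem stub_plaquetteDictionary :
    ∀ U : ℝ, 0 < U → PlaquetteData U → PlaquetteDictionary U :=
  fun U _ hPD => plaquetteDictionary_of_plaquetteData U hPD

end Summit.HubbardSuperconductivity.HubbardSuperconductivity.Theorems.LevyLogBootstrap

end
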